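import Literature.NumberTheory.EllipticCurves.IsogenyFromRationalMap
import Literature.NumberTheory.EllipticCurves.WeierstrassAddAtlas
import HarnessLib

/-!
# The chart of an isogeny formula: `Spec K[W₁][1/h] → E_{W₂}`

Let `φ = (U, h, S, T)` be an isogeny formula `W₁ → W₂` between Weierstrass curves over a field `K`
(`EllipticCurves/IsogenyFromRationalMap.IsogenyFormula`; Silverman, *AEC* Remark III.4.13.3: the standard
form `(x, y) ↦ (U(x)/h(x)², (S(x) y + T(x))/h(x)³)` of an isogeny). On the basic open `D(h) = Spec K[W₁][1/h]`
of the affine chart of `E_{W₁}` the formula is a MORPHISM into the affine chart of `E_{W₂}`: this file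
constructs it and identifies its values on geometric points with the isogeny `φ.toIsogeny` of the tree
(Silverman, *AEC* Thm. III.4.8).

* `IsogenyFormula.ChartRing φ = K[W₁][1/h]` and the pull-back `IsogenyFormula.psiB φ : K[W₂] → K[W₁][1/h]`,
  `x₂ ↦ U/h²`, `y₂ ↦ (S y₁ + T)/h³` (well defined by the curve identity, `equation_xB'_yB'`);
* `IsogenyFormula.chartι φ : Spec K[W₁][1/h] ↪ E_{W₁}` (open immersion over `K`) and
  `IsogenyFormula.chartμ φ : Spec K[W₁][1/h] → E_{W₂}` (over `K`);
* `IsogenyFormula.toGeomPoint_specPoint_chartμ` — **on `K̄`-points `chartμ` is `φ.toIsogeny ∘ chartι`**: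
  a `K̄`-point of `D(h)` is an affine point `(x, y)` of `W₁` with `h(x) ≠ 0`, and the formula there is the
  value of the isogeny (`IsogenyFormula.toIsogeny_some`).

This is the map chart (`EllipticCurves/WeierstrassMapAtlas`) from which the isogeny is glued as a morphism of
schemes `E_{W₁} → E_{W₂}` (sequel).

## References

* J. H. Silverman, *The Arithmetic of Elliptic Curves*, 2nd ed., GTM 106 (2009): II.2.1, III.1, Thm. III.4.8,
  Remark III.4.13.3. [SilvermanAEC2009]

## Design

`namespace WeierstrassCurve.IsogenyFormula` (dot notation on the formula). The target of the pull-back is the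
localization `Localization.Away (h(x₁))`, in which `h(x₁)` is inverted through `IsLocalization.Away.invSelf`; the
curve identity is transported from the polynomial identities of the formula by clearing the unit `h(x₁)`.
No named facts.
-/

noncomputable section

open CategoryTheory AlgebraicGeometry Limits Polynomial
open scoped Polynomial.Bivariate
open Literature.AlgebraicGeometry.Motives Literature.NumberTheory.EllipticCurves

universe u

-- tree idiom for scheme-level rewriting through `Over`/pullback API (cf. `WeierstrassAddAtlas`)
set_option backward.isDefEq.respectTransparency false

namespace WeierstrassCurve.IsogenyFormula

variable {K : Type u} [Field K] {W₁ W₂ : WeierstrassCurve K} (φ : IsogenyFormula W₁ W₂)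

/-! ### The ring `K[W₁][1/h]` and the pull-back of `K[W₂]` -/

section Ring

/-- `h(x₁) ∈ K[W₁]`. [folklore] -/
def hW : W₁.toAffine.CoordinateRing := algebraMap K[X] W₁.toAffine.CoordinateRing φ.h

/-- **`K[W₁][1/h]`**, the coordinate ring of the basic open `D(h)` of the affine chart of `E_{W₁}`.
[cite: SilvermanAEC2009, III.1] -/
abbrev ChartRing : Type u := Localization.Away φ.hW

/-- `p ↦ p(x₁) ∈ K[W₁][1/h]`. [folklore] -/
def toB : K[X] →+* φ.ChartRing :=
  (algebraMap W₁.toAffine.CoordinateRing φ.ChartRing).comp (algebraMap K[X] W₁.toAffine.CoordinateRing)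

/-- `x₁ ∈ K[W₁][1/h]`. [folklore] -/
def xB : φ.ChartRing :=
  algebraMap W₁.toAffine.CoordinateRing φ.ChartRing (xClass W₁)

/-- `y₁ ∈ K[W₁][1/h]`. [folklore] -/
def yB : φ.ChartRing :=
  algebraMap W₁.toAffine.CoordinateRing φ.ChartRing (yClass W₁)

/-- `toB X = x₁`. [folklore] -/
@[simp] theorem toB_X : φ.toB X = φ.xB := rfl

/-- `toB h = h(x₁)`. [folklore] -/
theorem toB_h : φ.toB φ.h = algebraMap W₁.toAffine.CoordinateRing φ.ChartRing φ.hW := rfl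

/-- `toB` on constants. [folklore] -/
@[simp] theorem toB_C (c : K) : φ.toB (C c) = algebraMap K φ.ChartRing c := by
  rw [toB, RingHom.comp_apply, show C c = algebraMap K K[X] c from rfl,
    ← IsScalarTower.algebraMap_apply K K[X] W₁.toAffine.CoordinateRing,
    ← IsScalarTower.algebraMap_apply K W₁.toAffine.CoordinateRing φ.ChartRing]

/-- `toB p = p(x₁)` computed by `eval₂` along `K → K[W₁][1/h]`. [folklore] -/
theorem eval₂_xB (p : K[X]) : p.eval₂ (algebraMap K φ.ChartRing) φ.xB = φ.toB p := by
  have : φ.toB = eval₂RingHom (algebraMap K φ.ChartRing) φ.xB := by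
    apply Polynomial.ringHom_ext
    · intro c
      rw [toB_C, coe_eval₂RingHom, eval₂_C]
    · rw [toB_X, coe_eval₂RingHom, eval₂_X]
  rw [this, coe_eval₂RingHom]

/-- `1/h(x₁) ∈ K[W₁][1/h]`. [folklore] -/
def hinv : φ.ChartRing := IsLocalization.Away.invSelf φ.hW

/-- `h(x₁) · (1/h(x₁)) = 1`. [folklore] -/
theorem toB_h_mul_hinv : φ.toB φ.h * φ.hinv = 1 := by
  rw [toB_h, hinv]
  exact IsLocalization.Away.mul_invSelf φ.hW

/-- `x' = U(x₁)/h(x₁)²`, the pull-back of `x₂`. [folklore] -/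
def xB' : φ.ChartRing := φ.toB φ.U * φ.hinv ^ 2

/-- `y' = (S(x₁) y₁ + T(x₁))/h(x₁)³`, the pull-back of `y₂`. [folklore] -/
def yB' : φ.ChartRing := (φ.toB φ.S * φ.yB + φ.toB φ.T) * φ.hinv ^ 3

/-- The Weierstrass relation between `x₁, y₁` in `K[W₁][1/h]`. [folklore] -/
theorem weierstrass_xB_yB :
    φ.yB ^ 2 + algebraMap K _ W₁.a₁ * φ.xB * φ.yB + algebraMap K _ W₁.a₃ * φ.yB =
      φ.xB ^ 3 + algebraMap K _ W₁.a₂ * φ.xB ^ 2 + algebraMap K _ W₁.a₄ * φ.xB + algebraMap K _ W₁.a₆ := by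
  have h := congrArg (algebraMap W₁.toAffine.CoordinateRing φ.ChartRing) (xy_relation W₁)
  simp only [map_sub, map_add, map_mul, map_pow, map_zero,
    ← IsScalarTower.algebraMap_apply K W₁.toAffine.CoordinateRing φ.ChartRing] at h
  rw [← sub_eq_zero]
  exact h

/-- **The curve identity**: `(x', y')` satisfies the equation of `W₂` in `K[W₁][1/h]` (from the two
polynomial identities of the formula, clearing the unit `h(x₁)`). [cite: SilvermanAEC2009, Remark III.4.13.3] -/
theorem equation_xB'_yB' :
    φ.yB' ^ 2 + algebraMap K _ W₂.a₁ * φ.xB' * φ.yB' + algebraMap K _ W₂.a₃ * φ.yB' =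
      φ.xB' ^ 3 + algebraMap K _ W₂.a₂ * φ.xB' ^ 2 + algebraMap K _ W₂.a₄ * φ.xB' +
        algebraMap K _ W₂.a₆ := by
  have h1 := φ.identity₁_eval₂ (algebraMap K φ.ChartRing) φ.xB
  have h0 := φ.identity₀_eval₂ (algebraMap K φ.ChartRing) φ.xB
  simp only [eval₂_xB] at h1 h0
  have hW := φ.weierstrass_xB_yB
  have hvw := φ.toB_h_mul_hinv
  -- abbreviations
  set u := φ.toB φ.U with hu
  set v := φ.toB φ.h with hv
  set s := φ.toB φ.S with hs
  set t := φ.toB φ.T with ht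
  set b := φ.yB with hb
  set a := φ.xB with ha
  set w := φ.hinv with hw
  set A₁ := algebraMap K φ.ChartRing W₂.a₁
  set A₂ := algebraMap K φ.ChartRing W₂.a₂
  set A₃ := algebraMap K φ.ChartRing W₂.a₃
  set A₄ := algebraMap K φ.ChartRing W₂.a₄
  set A₆ := algebraMap K φ.ChartRing W₂.a₆
  have key : (s * b + t) ^ 2 + A₁ * u * v * (s * b + t) + A₃ * v ^ 3 * (s * b + t) -
      (u ^ 3 + A₂ * u ^ 2 * v ^ 2 + A₄ * u * v ^ 4 + A₆ * v ^ 6) = 0 := by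
    linear_combination b * h1 + h0 + s ^ 2 * hW
  change ((s * b + t) * w ^ 3) ^ 2 + A₁ * (u * w ^ 2) * ((s * b + t) * w ^ 3) + A₃ * ((s * b + t) * w ^ 3) =
    (u * w ^ 2) ^ 3 + A₂ * (u * w ^ 2) ^ 2 + A₄ * (u * w ^ 2) + A₆
  linear_combination w ^ 6 * key -
    (A₁ * u * (s * b + t) * w ^ 5 + A₃ * (s * b + t) * w ^ 3 * (1 + v * w + v ^ 2 * w ^ 2) -
      A₂ * u ^ 2 * w ^ 4 * (1 + v * w) - A₄ * u * w ^ 2 * (1 + v * w + v ^ 2 * w ^ 2 + v ^ 3 * w ^ 3) -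
      A₆ * (1 + v * w + v ^ 2 * w ^ 2 + v ^ 3 * w ^ 3 + v ^ 4 * w ^ 4 + v ^ 5 * w ^ 5)) * hvw

/-- **The pull-back** `ψ : K[W₂] → K[W₁][1/h]`, `x₂ ↦ x'`, `y₂ ↦ y'` (well defined by the curve
identity), as a `K`-algebra map. [cite: SilvermanAEC2009, Remark III.4.13.3] -/
def psiB : W₂.toAffine.CoordinateRing →ₐ[K] φ.ChartRing :=
  W₂.affineEval φ.xB' φ.yB' <| by
    rw [equation_baseChange_iff]
    linear_combination φ.equation_xB'_yB'

/-- `ψ(x₂) = x'`. [folklore] -/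
@[simp] theorem psiB_xClass : φ.psiB (xClass W₂) = φ.xB' :=
  W₂.affineEval_xClass _ _ _

/-- `ψ(y₂) = y'`. [folklore] -/
@[simp] theorem psiB_yClass : φ.psiB (yClass W₂) = φ.yB' :=
  W₂.affineEval_yClass _ _ _

end Ring

/-! ### Geometric points of the affine chart -/

section AffinePoints

variable {K : Type u} [Field K] (W : WeierstrassCurve K) [W.IsElliptic]

local notation "K̄" => AlgebraicClosure K

omit φ in
/-- For `W` elliptic every solution of the Weierstrass equation over `K̄` is a nonsingular point.
[cite: SilvermanAEC2009, III.1 Prop. 1.4(a)] -/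
theorem _root_.WeierstrassCurve.nonsingular_of_equation_geom {x y : K̄}
    (h : (W.baseChange K̄).toAffine.Equation x y) : (W.baseChange K̄).toAffine.Nonsingular x y :=
  haveI : (W.baseChange (AlgebraicClosure K)).IsElliptic := inferInstanceAs ((W.map _).IsElliptic)
  (Affine.equation_iff_nonsingular_of_Δ_ne_zero
    ((W.baseChange K̄).coe_Δ' ▸ (W.baseChange K̄).Δ'.ne_zero)).mp h

omit φ in
/-- **The `K̄`-point of the affine chart given by a `K`-algebra map `γ : K[W] → K̄` is the affine point
`(γ x̄, γ ȳ)`** (Silverman, *AEC* III.1: the affine points of `E_W`). [cite: SilvermanAEC2009, III.1] -/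
theorem _root_.WeierstrassCurve.toGeomPoint_specOverOfAlgHom_comp_affineChart
    (γ : W.toAffine.CoordinateRing →ₐ[K] K̄) :
    W.toGeomPoint (specOverOfAlgHom γ ≫ W.affineChart) =
      .some (γ (xClass W)) (γ (yClass W)) (W.nonsingular_of_equation_geom (W.equation_algHom γ)) := by
  set x := γ (xClass W)
  set y := γ (yClass W)
  have h : (W.baseChange K̄).toAffine.Equation x y := W.equation_algHom γ
  have hγ : γ = W.affineEval x y h :=
    W.affine_algHom_ext (by rw [affineEval_xClass]) (by rw [affineEval_yClass])
  apply (W.pointEquiv (L := K̄)).injective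
  rw [pointEquiv_toGeomPoint]
  change _ = W.pointEquiv (Affine.Point.some x y _)
  rw [pointEquiv_some]
  have e : specOverOfAlgHom γ ≫ W.affineChart = W.chartPoint W.affineChart.left W.affineChart_over x y h :=
    Over.OverMorphism.ext (by rw [Over.comp_left, specOverOfAlgHom_left, chartPoint_left, hγ])
  exact e.trans (W.chartPoint_affineChart x y h)

end AffinePoints

/-! ### The chart morphisms `Spec K[W₁][1/h] ↪ E_{W₁}` and `Spec K[W₁][1/h] → E_{W₂}` -/

section Chart

variable [W₁.IsElliptic] [W₂.IsElliptic]

local notation "K̄" => AlgebraicClosure K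

/-- `K[W₁] → K[W₁][1/h]` as a `K`-algebra map. [folklore] -/
abbrev locₐ : W₁.toAffine.CoordinateRing →ₐ[K] φ.ChartRing :=
  IsScalarTower.toAlgHom K W₁.toAffine.CoordinateRing φ.ChartRing

/-- **The source immersion `Spec K[W₁][1/h] → Spec K[W₁] → E_{W₁}`** over `K` (a basic open of the affine
chart). [cite: SilvermanAEC2009, III.1] -/
def chartι : specOver K φ.ChartRing ⟶ W₁.scheme :=
  specOverOfAlgHom φ.locₐ ≫ W₁.affineChart

omit [W₁.IsElliptic] [W₂.IsElliptic] in
/-- Underlying morphism of `chartι`. [folklore] -/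
theorem chartι_left : φ.chartι.left =
    Spec.map (CommRingCat.ofHom (algebraMap W₁.toAffine.CoordinateRing φ.ChartRing)) ≫ W₁.chartHom :=
  rfl

/-- The source of the formula chart is an open of `E_{W₁}`. [folklore] -/
instance isOpenImmersion_chartι_left : IsOpenImmersion φ.chartι.left := by
  rw [chartι_left]
  haveI := W₁.isOpenImmersion_chartHom
  infer_instance

/-- **The value morphism `Spec K[W₁][1/h] → Spec K[W₂] → E_{W₂}`** over `K`: `Spec` of the pull-back `ψ`.
[cite: SilvermanAEC2009, Thm. III.4.8 and Remark III.4.13.3] -/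
def chartμ : specOver K φ.ChartRing ⟶ W₂.scheme :=
  specOverOfAlgHom φ.psiB ≫ W₂.affineChart

omit [W₁.IsElliptic] [W₂.IsElliptic] in
/-- `β` of a polynomial in `x₁` is its value at `β x₁` over `K̄`. [folklore] -/
theorem apply_toB (β : φ.ChartRing →ₐ[K] K̄) (p : K[X]) : β (φ.toB p) = (p.map (algebraMap K K̄)).eval (β φ.xB) := by
  rw [← eval₂_xB, eval_map, ← AlgHom.coe_toRingHom, Polynomial.hom_eval₂]
  congr 1
  ext c
  exact β.commutes c

omit [W₁.IsElliptic] [W₂.IsElliptic] in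
/-- The exceptional polynomial of the formula read over `K̄` is `h` mapped to `K̄`. [folklore] -/
theorem geom_h : φ.geom.h = φ.h.map (algebraMap K K̄) := rfl

omit [W₁.IsElliptic] [W₂.IsElliptic] in
/-- `h(x) ≠ 0` at a `K̄`-point `(x, y)` of `D(h)`. [folklore] -/
theorem eval_h_ne_zero (β : φ.ChartRing →ₐ[K] K̄) : φ.geom.h.eval (β φ.xB) ≠ 0 := by
  have hu : IsUnit (φ.toB φ.h) := isUnit_iff_exists_inv.mpr ⟨φ.hinv, φ.toB_h_mul_hinv⟩
  have hne : β (φ.toB φ.h) ≠ 0 := (hu.map β).ne_zero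
  rwa [apply_toB, ← geom_h] at hne

omit [W₂.IsElliptic] in
/-- The source point of the chart at `β` is the affine point `(β x₁, β y₁)`. [folklore] -/
theorem toGeomPoint_specOverOfAlgHom_comp_chartι (β : φ.ChartRing →ₐ[K] K̄) :
    W₁.toGeomPoint (specOverOfAlgHom β ≫ φ.chartι) =
      .some (β φ.xB) (β φ.yB) (W₁.nonsingular_of_equation_geom (W₁.equation_algHom (β.comp φ.locₐ))) := by
  rw [chartι, ← Category.assoc, ← specOverOfAlgHom_comp]
  exact W₁.toGeomPoint_specOverOfAlgHom_comp_affineChart (β.comp φ.locₐ)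

omit [W₁.IsElliptic] in
/-- The value point of the chart at `β` is the affine point `(β x', β y')`. [folklore] -/
theorem toGeomPoint_specOverOfAlgHom_comp_chartμ (β : φ.ChartRing →ₐ[K] K̄) :
    W₂.toGeomPoint (specOverOfAlgHom β ≫ φ.chartμ) =
      .some (β φ.xB') (β φ.yB') (by
        simpa only [AlgHom.comp_apply, psiB_xClass, psiB_yClass] using
          W₂.nonsingular_of_equation_geom (W₂.equation_algHom (β.comp φ.psiB))) := by
  rw [chartμ, ← Category.assoc, ← specOverOfAlgHom_comp]
  have h := W₂.toGeomPoint_specOverOfAlgHom_comp_affineChart (β.comp φ.psiB)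
  rw [h]
  congr 1 <;> simp only [AlgHom.comp_apply, psiB_xClass, psiB_yClass]

omit [W₁.IsElliptic] [W₂.IsElliptic] in
/-- `β (1/h) = (h(β x₁))⁻¹`. [folklore] -/
theorem apply_hinv (β : φ.ChartRing →ₐ[K] K̄) : β φ.hinv = ((φ.h.map (algebraMap K K̄)).eval (β φ.xB))⁻¹ := by
  have h1 : β (φ.toB φ.h) * β φ.hinv = 1 := by rw [← map_mul, toB_h_mul_hinv, map_one]
  rw [apply_toB] at h1
  exact (eq_inv_of_mul_eq_one_right h1)

/-- **The formula chart computes the isogeny on `K̄`-points**: the value point at `β` is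
`φ.toIsogeny` of the source point (Silverman, *AEC* Thm. III.4.8: off `{O} ∪ {h = 0}` the isogeny is the
formula, `IsogenyFormula.toIsogeny_some`). [cite: SilvermanAEC2009, Thm. III.4.8 (PDF pp. 70–71)] -/
theorem toGeomPoint_chartμ_eq_toIsogeny [CharZero K] (β : φ.ChartRing →ₐ[K] K̄) :
    W₂.toGeomPoint (specOverOfAlgHom β ≫ φ.chartμ) = φ.toIsogeny (W₁.toGeomPoint (specOverOfAlgHom β ≫ φ.chartι)) := by
  classical
  rw [toGeomPoint_specOverOfAlgHom_comp_chartμ, toGeomPoint_specOverOfAlgHom_comp_chartι,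
    φ.toIsogeny_some _ (φ.eval_h_ne_zero β)]
  have hh : (φ.h.map (algebraMap K K̄)).eval (β φ.xB) ≠ 0 := φ.eval_h_ne_zero β
  congr 1
  · rw [xB', map_mul, map_pow, apply_toB, apply_hinv, valX]
    change _ = (φ.U.map (algebraMap K K̄)).eval (β φ.xB) / (φ.h.map (algebraMap K K̄)).eval (β φ.xB) ^ 2
    field_simp
  · rw [yB', map_mul, map_pow, map_add, map_mul, apply_toB, apply_toB, apply_hinv, valY]
    change _ = ((φ.S.map (algebraMap K K̄)).eval (β φ.xB) * β φ.yB + (φ.T.map (algebraMap K K̄)).eval (β φ.xB)) /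
      (φ.h.map (algebraMap K K̄)).eval (β φ.xB) ^ 3
    field_simp

end Chart

end WeierstrassCurve.IsogenyFormula

end
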